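import Literature.AlgebraicGeometry.HodgeTheory.DirectImageTransport
import Literature.AlgebraicGeometry.HodgeTheory.ComplexConjugation
import HarnessLib

/-!
# Transport in `Rᵏ π_* ℂ|_U` commutes with complex conjugation

Family `hodge`, layer `Literature/AlgebraicGeometry/HodgeTheory`. A small complement to
`DirectImageTransport`: for `π : 𝒳 ⟶ S` and a cohomologically locally trivial
`U ⊆ S(ℂ)` (`IsCohomologicallyLocallyTrivialOn π U`), the parallel transport
`transportFun π k hU γ : Hᵏ(X_s(ℂ); ℂ) → Hᵏ(X_t(ℂ); ℂ)` along a homotopy class of paths `γ` in `U`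
commutes with complex conjugation of classes (`transportFun_conjClass`): the local system
`Rᵏ π_* ℂ = Rᵏ π_* ℝ ⊗ ℂ` has a real structure, i.e. transport is defined over `ℝ`
(Voisin II, §3.1.2: the local systems `Rᵏ π_* A`, `A = ℤ, ℚ, ℝ, ℂ`, arise from one another by
extension of scalars). Proof: transport commutes with every fibrewise operation induced from
tube classes (`transportFun_op₂`, uniqueness and continuity of lifts in the espace étalé), and
conjugation is natural for the restrictions `Hᵏ(π⁻¹B(ℂ); ℂ) → Hᵏ(X_t(ℂ); ℂ)` (`conjClass_map`).

Not here (already in the tree): transport along the reversed path inverts transport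
(`transportFun_symm_transportFun`, `HodgeGenericTypeStabilityOfGenericPoint`) and transport is
injective (`transportFun_injective`, `FlatSectionNonvanishing`); linearity and multiplicativity
of transport (`DirectImageTransport`); any analytic input (Ehresmann's theorem for `π(ℂ)`).

## References

* [VoisinHodgeII2003] C. Voisin, Hodge Theory and Complex Algebraic Geometry II, CUP 2003, §3.1.2.
* [VoisinHodgeI2002] C. Voisin, Hodge Theory and Complex Algebraic Geometry I, CUP 2002, §9.2.1,
  Cor. 6.12.
-/

noncomputable section

open CategoryTheory AlgebraicGeometry
open Literature.AlgebraicTopology.SingularHomology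

namespace Literature.AlgebraicGeometry.HodgeTheory

section HodgeTheory

variable {𝒳 S : Motives.SchemeOver ℂ} (π : 𝒳 ⟶ S) (k : ℕ) {U : Set (Motives.ComplexPoints S)}
  (hU : IsCohomologicallyLocallyTrivialOn π U)

/-- **Transport commutes with complex conjugation**: `γ_* (conj α) = conj (γ_* α)` for the
parallel transport of `Rᵏ π_* ℂ|_U` along a homotopy class of paths `γ` in a cohomologically
locally trivial `U` (the local system `Rᵏ π_* ℂ = Rᵏ π_* ℝ ⊗ ℂ` is defined over `ℝ`; transport
commutes with the fibrewise operations induced from tube classes, and conjugation is natural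
for restriction to fibres). [cite: VoisinHodgeII2003, §3.1.2] -/
theorem transportFun_conjClass {s t : U} (γ : Path.Homotopic.Quotient s t)
    (α : complexBetti (Motives.fiberOver π s.1) k) :
    transportFun π k hU γ (conjClass (Motives.ComplexPoints (Motives.fiberOver π s.1)) k α) =
      conjClass (Motives.ComplexPoints (Motives.fiberOver π t.1)) k (transportFun π k hU γ α) :=
  transportFun_op₂ π hU (k₂ := k)
    (fun t x _ ↦ conjClass (Motives.ComplexPoints (Motives.fiberOver π t)) k x)
    (fun B ξ _ ↦ conjClass (tubeOver π B) k ξ)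
    (fun _ _ ht ξ _ ↦ conjClass_map (fiberToTube π ht) ξ) γ α α

end HodgeTheory

end Literature.AlgebraicGeometry.HodgeTheory

end
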